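import Mathlib.AlgebraicGeometry.Morphisms.Proper
import Mathlib.AlgebraicGeometry.Morphisms.UniversallyOpen
import Mathlib.AlgebraicGeometry.PullbackCarrier
import Mathlib.AlgebraicGeometry.FunctionField
import Mathlib.CategoryTheory.Comma.Over.Pullback
import HarnessLib

/-!
# Surjectivity spreads from a generising base change, and restricts to fibres (`Over S` / `Over.pullback` form)

Topic `Literature/AlgebraicGeometry/Limits` (EGA IV₂ §2.3 «morphismes plats et générisations»); namespace
`Literature.AlgebraicGeometry.Limits`.  KERNEL ONLY: theorems; no definition, no named fact, no `sorry`.  Mathlib-only.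
Companion of `SurjectiveOfGenericFibre.lean` (the same mathematics for bare morphisms `f : X ⟶ Y`, `q : Y ⟶ S` over an
irreducible base); here the statements are in the `Over S` / `Over.pullback g` currency of the III-0 road (A-p14's SPEC
`SPEC-III0-pieces.md` §F4, heads verbatim) and the base `S` need not be irreducible: it suffices that the image of
`g : S' ⟶ S` GENERISES every point of `S`.

* `surjective_left_of_surjective_pullback_map_left` (F4a) — `Y → S` flat (generalisations lift, Mathlib
  `Flat.generalizingMap`), `f : X ⟶ Y` in `Over S` with `f.left` universally closed, every point of `S` a specialisation of
  a point `g s'`: if `(Over.pullback g).map f` is surjective then so is `f`.  (For `y ∈ Y`: `g s' ⤳ q y` lifts to `y' ⤳ y`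
  with `q y' = g s'`; `y'` comes from `Y ×_S S'`, hence from `X ×_S S'`, hence lies in the image of `f`, which is closed.)
* `surjective_pullback_map_left` (F4b) — conversely every `(Over.pullback i).map f` of a surjective `f` is surjective
  (the square over `f.left` is cartesian; Mathlib's base-change stability of `Surjective`).
* `forall_exists_specializes_of_injective` (F4c) — for an injective `ψ : T → K` from a domain to a field,
  `Spec K → Spec T` hits the generic point, which generises everything.

## References
* [EGAIV2] A. Grothendieck, J. Dieudonné, EGA IV₂ (Publ. Math. IHÉS 24, 1965), Prop. 2.3.4 (a flat morphism is
  generalising), Cor. 2.3.5.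
* [StacksProject] The Stacks Project, Tag 03HV (generalisations lift along flat morphisms).
-/

set_option autoImplicit false

noncomputable section

universe u

open CategoryTheory CategoryTheory.Limits AlgebraicGeometry TopologicalSpace Topology

namespace Literature.AlgebraicGeometry.Limits

/-- the base change of `f : X ⟶ Y` in `Over S` along `g : S' ⟶ S` sits over `f.left`:
`((Over.pullback g).map f).left ≫ pr_Y = pr_X ≫ f.left`. [cite: EGAIV2, Prop. 2.3.4] -/
theorem pullback_map_left_comp_fst {S S' : Scheme.{u}} (g : S' ⟶ S) {X Y : Over S} (f : X ⟶ Y) :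
    ((Over.pullback g).map f).left ≫ pullback.fst Y.hom g = pullback.fst X.hom g ≫ f.left := by
  change pullback.lift _ _ _ ≫ _ = _
  exact pullback.lift_fst _ _ _

/-- the base-change square over `f.left` is cartesian: `X ×_S S'` is the pullback of `Y ×_S S' ⟶ Y` along `f.left`.
[cite: EGAIV2, Prop. 2.3.4] -/
theorem isPullback_pullback_map_left {S S' : Scheme.{u}} (g : S' ⟶ S) {X Y : Over S} (f : X ⟶ Y) :
    IsPullback ((Over.pullback g).map f).left (pullback.fst X.hom g) (pullback.fst Y.hom g) f.left := by
  have e1 : ((Over.pullback g).map f).left ≫ pullback.snd Y.hom g = pullback.snd X.hom g := by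
    change pullback.lift _ _ _ ≫ _ = _
    exact pullback.lift_snd _ _ _
  have hbig : IsPullback (((Over.pullback g).map f).left ≫ pullback.snd Y.hom g) (pullback.fst X.hom g) g
      (f.left ≫ Y.hom) := by
    rw [e1, Over.w f]
    exact (IsPullback.of_hasPullback X.hom g).flip
  exact IsPullback.of_right hbig (pullback_map_left_comp_fst g f) (IsPullback.of_hasPullback Y.hom g).flip

/-- **F4b.  Base changes of surjective morphisms are surjective** (`Over.pullback` form): if `f.left` is surjective then
so is `((Over.pullback i).map f).left` — in particular every fibre of a surjective `S`-morphism is surjective.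
[cite: EGAIV2, Prop. 2.3.4] [cite: StacksProject, Tag 03HV] -/
theorem surjective_pullback_map_left {S S' : Scheme.{u}} (i : S' ⟶ S) {X Y : Over S} (f : X ⟶ Y)
    [Surjective f.left] : Surjective ((Over.pullback i).map f).left :=
  MorphismProperty.of_isPullback (P := @Surjective) (isPullback_pullback_map_left i f).flip inferInstance

/-- **F4a.  SURJECTIVITY SPREADS FROM A GENERISING BASE CHANGE.**  `f : X ⟶ Y` in `Over S` with `Y → S` FLAT
(generalisations lift along it) and `f.left` UNIVERSALLY CLOSED (e.g. `X` proper and `Y` separated over `S`); `g : S' ⟶ S`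
such that every point of `S` is a specialisation of some `g s'` (e.g. `S` integral and `g` hits the generic point).  If the
base change `(Over.pullback g).map f` is surjective, then `f` is surjective.  Proof: for `y ∈ Y` pick `g s' ⤳ q y`, lift to
`y' ⤳ y` with `q y' = g s'` (going down); `y'` is the image of a point of `Y ×_S S'`, hence of `X ×_S S'`, hence `y' ∈ f(X)`;
`f(X)` is closed, so `y ∈ f(X)`. [cite: EGAIV2, Prop. 2.3.4, Cor. 2.3.5] [cite: StacksProject, Tag 03HV] -/
theorem surjective_left_of_surjective_pullback_map_left {S S' : Scheme.{u}} (g : S' ⟶ S) {X Y : Over S} (f : X ⟶ Y)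
    [Flat Y.hom] [UniversallyClosed f.left] (hg : ∀ s : S, ∃ s' : S', g.base s' ⤳ s)
    [Surjective ((Over.pullback g).map f).left] : Surjective f.left := by
  refine ⟨fun y => ?_⟩
  obtain ⟨s', hs'⟩ := hg (Y.hom y)
  -- going down along the flat `Y.hom`: a generisation `y'` of `y` over `g s'`
  obtain ⟨y', hy'y, hqy'⟩ := Flat.generalizingMap Y.hom (a := y) (b := g.base s') hs'
  -- `y'` comes from `Y ×_S S'`, hence (surjectivity upstairs) from `X ×_S S'`, hence lies in the image of `f.left`
  have hy' : y' ∈ Set.range (pullback.fst Y.hom g) := by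
    rw [Scheme.Pullback.range_fst]
    exact ⟨s', hqy'.symm⟩
  obtain ⟨z, rfl⟩ := hy'
  obtain ⟨w, rfl⟩ := ((Over.pullback g).map f).left.surjective z
  have hmem : (pullback.fst Y.hom g) (((Over.pullback g).map f).left w) ∈ Set.range f.left :=
    ⟨pullback.fst X.hom g w, by
      rw [← Scheme.Hom.comp_apply, ← pullback_map_left_comp_fst g f]
      rfl⟩
  -- the image of `f.left` is closed, hence stable under specialisation
  exact hy'y.mem_closed f.left.isClosedMap.isClosed_range hmem

/-- **F4c.  The generic-point hypothesis for an affine domain.**  For an injective ring map `ψ : T → K` from a domain into a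
field, every point of `Spec T` is a specialisation of a point in the image of `Spec K → Spec T` (namely of the generic point
`ker ψ = 0`). [cite: EGAIV2, Prop. 2.3.4] -/
theorem forall_exists_specializes_of_injective {T K : Type u} [CommRing T] [IsDomain T] [Field K] (ψ : T →+* K)
    (hψ : Function.Injective ψ) :
    ∀ s : Spec (.of T), ∃ s' : Spec (.of K), (Spec.map (CommRingCat.ofHom ψ)).base s' ⤳ s := by
  intro s
  refine ⟨(⊥ : PrimeSpectrum K), ?_⟩
  have h : (Spec.map (CommRingCat.ofHom ψ)).base (⊥ : PrimeSpectrum K) = genericPoint (Spec (.of T)) := by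
    rw [genericPoint_eq_bot_of_affine]
    change PrimeSpectrum.comap ψ ⊥ = ⊥
    apply PrimeSpectrum.ext
    change Ideal.comap ψ (⊥ : Ideal K) = ⊥
    exact Ideal.comap_bot_of_injective ψ hψ
  rw [h]
  exact genericPoint_specializes s

end Literature.AlgebraicGeometry.Limits

end
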